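import Mathlib
import Literature.NumberTheory.Transcendental.KZCubeProducts
import Literature.NumberTheory.Transcendental.KontsevichZagierGammaProofs
import Literature.Analysis.SpecialFunctions.LemniscateConstant
import HarnessLib
import HarnessLib.Audit

/-!
# SoloInformed — values of the lemniscate sector and their transcendence (Chudnovsky)

Theorem IX of the residency paper (§6octies), kernel part (b): the VALUE side of the lemniscate
sector of the Kontsevich–Zagier conjecture.

* `soloInformed_value_betaRep` — the value of a representation pinned as Euler's Beta integral
  `β(a,b) = [(0,1), t^{a−1}(1−t)^{b−1}]` (`a, b ∈ ℚ_{>0}`) is `Γ(a)Γ(b)/Γ(a+b)`.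
* `soloInformed_value_betaQuarterHalf` — `B(¼,½) = Γ(¼)²/√(2π)` (`= 2ϖ`, twice the lemniscate
  constant; Lawden 1989, (4.3.5)).
* `soloInformed_algebraicIndependent_pair_transfer` — transfer of algebraic independence of a pair
  `(x, y)` to a pair `(a, b)` over which `x`, `y` are radical: the transcendence-degree count of
  Chudnovsky's CM endgame, isolated as a lemma over `ℝ`.
* `soloInformed_algebraicIndependent_betaQuarterHalf_pi` — **`B(¼,½)` and `π` are algebraically
  independent over `ℚ`**, from the tree theorem
  `Literature.NumberTheory.Transcendental.algebraicIndependent_real_pi_gamma_one_quarter`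
  (Chudnovsky 1976: `π, Γ(¼)` algebraically independent) and `Γ(¼)⁴ = 2π·B(¼,½)²`.

With the sibling `SoloInformedEulerLemniscate.lean` (`⟦β(¼,½)⟧⟦β(¾,½)⟧ = 4⟦π⟧` inside the rules) this
decides the conjecture on the sector `ℤ[⟦β(¼,½)⟧, ⟦β(¾,½)⟧, ⟦π⟧] ⊂ P` (`SoloInformedLemniscateSector.lean`).
Residency `solo-KontsevichZagierPeriods-informed` (s22).

References: G. V. Chudnovsky, *Contributions to the theory of transcendental numbers*, AMS Math.
Surveys 19 (1984), Ch. 7, Cor. 2.3; M. Waldschmidt, *Elliptic functions and transcendence*, Surveys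
in number theory (2008), Cor. 33; D. F. Lawden, *Elliptic functions and applications* (1989), §4.3.
-/

noncomputable section

open MeasureTheory Set Filter
namespace Summit.KontsevichZagierPeriods.KontsevichZagierPeriods.Theorems

open Literature.NumberTheory.Transcendental Literature.NumberTheory.Transcendental.KZ
open Literature.ModelTheory.ExponentialFields

/-! ### Values of pinned Beta representations -/

/-- The coordinate spelling of `(0,1) ⊂ ℝ¹` is the preimage of `(0,1)` under `t ↦ t 0`. -/
theorem soloInformed_setOf_apply_mem_Ioo_eq_preimage :
    {t : Fin 1 → ℝ | t 0 ∈ Set.Ioo (0:ℝ) 1} =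
      (MeasurableEquiv.funUnique (Fin 1) ℝ) ⁻¹' Set.Ioo (0:ℝ) 1 := by
  ext t
  simp [MeasurableEquiv.funUnique, Fin.default_eq_zero]

/-- **Value of a pinned Beta representation**: `value β(a,b) = Γ(a)Γ(b)/Γ(a+b)` for rational
`a, b > 0` (transport to `ℝ` along `ℝ¹ ≃ ℝ` and Euler's Beta integral,
`Literature.Analysis.SpecialFunctions.Selberg.integrableOn_Ioo_rpow_mul_one_sub_rpow_and_integral_eq`).
[Andrews–Askey–Roy 1999, Thm. 1.1.4] -/
theorem soloInformed_value_betaRep (a b : ℚ) (ha : 0 < a) (hb : 0 < b) (B : IntegralRep 1)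
    (hBd : B.domain = {t | t 0 ∈ Set.Ioo (0:ℝ) 1})
    (hBi : Set.EqOn B.integrand
      (fun t => (t 0) ^ ((a : ℝ) - 1) * (1 - t 0) ^ ((b : ℝ) - 1)) B.domain) :
    B.value = Real.Gamma a * Real.Gamma b / Real.Gamma ((a + b : ℚ) : ℝ) := by
  have haR : (0:ℝ) < a := by exact_mod_cast ha
  have hbR : (0:ℝ) < b := by exact_mod_cast hb
  have hmeas : MeasurableSet B.domain := B.isSemialgebraic_domain.measurableSet_holds
  have h0 : B.value = ∫ t in B.domain, (t 0) ^ ((a : ℝ) - 1) * (1 - t 0) ^ ((b : ℝ) - 1) :=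
    setIntegral_congr_fun hmeas hBi
  have hmp : MeasurePreserving (MeasurableEquiv.funUnique (Fin 1) ℝ) volume volume :=
    volume_preserving_funUnique (Fin 1) ℝ
  have h1 : ∫ t in {t : Fin 1 → ℝ | t 0 ∈ Set.Ioo (0:ℝ) 1},
      (t 0) ^ ((a : ℝ) - 1) * (1 - t 0) ^ ((b : ℝ) - 1) =
      ∫ x in Set.Ioo (0:ℝ) 1, x ^ ((a : ℝ) - 1) * (1 - x) ^ ((b : ℝ) - 1) := by
    rw [soloInformed_setOf_apply_mem_Ioo_eq_preimage]
    exact hmp.setIntegral_preimage_emb (MeasurableEquiv.funUnique (Fin 1) ℝ).measurableEmbedding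
      (fun x => x ^ ((a : ℝ) - 1) * (1 - x) ^ ((b : ℝ) - 1)) (Set.Ioo 0 1)
  rw [h0, hBd, h1, (Literature.Analysis.SpecialFunctions.Selberg.integrableOn_Ioo_rpow_mul_one_sub_rpow_and_integral_eq
    haR hbR).2, Rat.cast_add]

/-- **`B(¼,½) = Γ(¼)²/√(2π)`** for a representation pinned as `β(¼,½) = [(0,1), t^{−3/4}(1−t)^{−1/2}]`
(`Γ(¼)Γ(½)/Γ(¾) = Γ(¼)²/√(2π)` by reflection,
`Literature.Analysis.SpecialFunctions.Gamma_quarter_mul_Gamma_half_div_Gamma_three_quarters`).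
[Lawden 1989, (4.3.5)] -/
theorem soloInformed_value_betaQuarterHalf (B₁ : IntegralRep 1)
    (h₁d : B₁.domain = {t | t 0 ∈ Set.Ioo (0:ℝ) 1})
    (h₁i : Set.EqOn B₁.integrand
      (fun t => (t 0) ^ (((1 / 4 : ℚ) : ℝ) - 1) * (1 - t 0) ^ (((1 / 2 : ℚ) : ℝ) - 1)) B₁.domain) :
    B₁.value = Real.Gamma (1 / 4) ^ 2 / Real.sqrt (2 * Real.pi) := by
  rw [soloInformed_value_betaRep (1 / 4) (1 / 2) (by norm_num) (by norm_num) B₁ h₁d h₁i,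
    ← Literature.Analysis.SpecialFunctions.Gamma_quarter_mul_Gamma_half_div_Gamma_three_quarters]
  norm_num

/-- `B(¼,½) > 0`. -/
theorem soloInformed_value_betaQuarterHalf_pos (B₁ : IntegralRep 1)
    (h₁d : B₁.domain = {t | t 0 ∈ Set.Ioo (0:ℝ) 1})
    (h₁i : Set.EqOn B₁.integrand
      (fun t => (t 0) ^ (((1 / 4 : ℚ) : ℝ) - 1) * (1 - t 0) ^ (((1 / 2 : ℚ) : ℝ) - 1)) B₁.domain) :
    0 < B₁.value := by
  rw [soloInformed_value_betaQuarterHalf B₁ h₁d h₁i]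
  have hΓ : 0 < Real.Gamma (1 / 4) := Real.Gamma_pos_of_pos (by norm_num)
  have hs : 0 < Real.sqrt (2 * Real.pi) := Real.sqrt_pos.mpr (by positivity)
  positivity

/-- `Γ(¼)⁴ = 2π · B(¼,½)²`. [Lawden 1989, (4.3.5)] -/
theorem soloInformed_gamma_quarter_pow_four (B₁ : IntegralRep 1)
    (h₁d : B₁.domain = {t | t 0 ∈ Set.Ioo (0:ℝ) 1})
    (h₁i : Set.EqOn B₁.integrand
      (fun t => (t 0) ^ (((1 / 4 : ℚ) : ℝ) - 1) * (1 - t 0) ^ (((1 / 2 : ℚ) : ℝ) - 1)) B₁.domain) :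
    Real.Gamma (1 / 4) ^ 4 = 2 * Real.pi * B₁.value ^ 2 := by
  rw [soloInformed_value_betaQuarterHalf B₁ h₁d h₁i, div_pow, Real.sq_sqrt (by positivity)]
  have hπ : Real.pi ≠ 0 := Real.pi_ne_zero
  field_simp

/-! ### Transfer of algebraic independence along a radical extension -/

/-- **Transcendence-degree transfer** (the count in Chudnovsky's CM endgame, over `ℝ`): if `x, y`
are algebraically independent over `ℚ` and some positive powers `x^k`, `y^l` lie in `ℚ(a, b)`, then
`a, b` are algebraically independent over `ℚ` — `ℚ(a,b)(x,y)` is algebraic over `ℚ(a,b)`, so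
`trdeg ℚ(a,b) = trdeg ℚ(a,b)(x,y) ≥ 2`, and `ℚ(a,b)` has the two generators `a, b`
(`Literature.Barriers.Schanuel.algebraicIndependent_of_le_trdeg_adjoin`).
[Waldschmidt 2008, §5.2, Cor. 31–33] -/
theorem soloInformed_algebraicIndependent_pair_transfer {x y a b : ℝ}
    (h : AlgebraicIndependent ℚ ![x, y])
    (hx : ∃ k : ℕ, 0 < k ∧ x ^ k ∈ IntermediateField.adjoin ℚ ({a, b} : Set ℝ))
    (hy : ∃ l : ℕ, 0 < l ∧ y ^ l ∈ IntermediateField.adjoin ℚ ({a, b} : Set ℝ)) :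
    AlgebraicIndependent ℚ ![a, b] := by
  obtain ⟨k, hk, hxk⟩ := hx
  obtain ⟨l, hl, hyl⟩ := hy
  set K : IntermediateField ℚ ℝ := IntermediateField.adjoin ℚ ({a, b} : Set ℝ) with hK
  set A : IntermediateField K ℝ := algebraicClosure K ℝ with hA
  have hKA : ∀ z : ℝ, z ∈ K → z ∈ A := fun z hz ↦ by simpa using A.algebraMap_mem ⟨z, hz⟩
  have hA_of_pow : ∀ (z : ℝ) (m : ℕ), 0 < m → z ^ m ∈ A → z ∈ A := fun z m hm hz ↦
    mem_algebraicClosure_iff.mpr (IsAlgebraic.of_pow hm (mem_algebraicClosure_iff.mp hz))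
  have hxA : x ∈ A := hA_of_pow _ k hk (hKA _ hxk)
  have hyA : y ∈ A := hA_of_pow _ l hl (hKA _ hyl)
  set T : Set ℝ := {x, y} with hT
  have hTalg : ∀ t ∈ T, IsAlgebraic K t := by
    rintro t (rfl | rfl)
    · exact mem_algebraicClosure_iff.mp hxA
    · exact mem_algebraicClosure_iff.mp hyA
  let E : IntermediateField K ℝ := IntermediateField.adjoin K T
  haveI : Algebra.IsAlgebraic K E :=
    IntermediateField.isAlgebraic_adjoin fun t ht ↦ (hTalg t ht).isIntegral
  haveI : FaithfulSMul ℚ K :=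
    (faithfulSMul_iff_algebraMap_injective ℚ K).mpr (algebraMap ℚ K).injective
  haveI : FaithfulSMul K E :=
    (faithfulSMul_iff_algebraMap_injective K E).mpr (algebraMap K E).injective
  have hE : Algebra.trdeg ℚ E = Algebra.trdeg ℚ K := by
    rw [← trdeg_add_eq ℚ K (A := E), trdeg_eq_zero (R := K) (A := E), add_zero]
  have hu : x ∈ E := IntermediateField.subset_adjoin K T (by simp [hT])
  have hv : y ∈ E := IntermediateField.subset_adjoin K T (by simp [hT])
  let g : Fin 2 → E := ![⟨_, hu⟩, ⟨_, hv⟩]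
  have hg : AlgebraicIndependent ℚ g := by
    refine AlgebraicIndependent.of_comp (IsScalarTower.toAlgHom ℚ E ℝ) ?_
    convert h using 1
    ext i
    fin_cases i <;> rfl
  have h2 : (2 : Cardinal) ≤ Algebra.trdeg ℚ K := by
    calc (2 : Cardinal) = Cardinal.mk (Fin 2) := by simp
      _ ≤ Algebra.trdeg ℚ E := hg.cardinalMk_le_trdeg
      _ = Algebra.trdeg ℚ K := hE
  refine Literature.Barriers.Schanuel.algebraicIndependent_of_le_trdeg_adjoin _ ?_
  rw [Matrix.range_cons_cons_empty]
  exact_mod_cast h2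

/-! ### Chudnovsky on the lemniscate sector -/

/-- **`B(¼,½)` and `π` are algebraically independent over `ℚ`** (Chudnovsky 1976 in the Beta
normalisation): `π ∈ ℚ(B, π)` and `Γ(¼)⁴ = 2π B² ∈ ℚ(B, π)`, while `π, Γ(¼)` are algebraically
independent (`algebraicIndependent_real_pi_gamma_one_quarter`, a tree theorem).
[Chudnovsky 1984, Ch. 7, Cor. 2.3; Waldschmidt 2008, Cor. 33] -/
theorem soloInformed_algebraicIndependent_betaQuarterHalf_pi (B₁ : IntegralRep 1)
    (h₁d : B₁.domain = {t | t 0 ∈ Set.Ioo (0:ℝ) 1})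
    (h₁i : Set.EqOn B₁.integrand
      (fun t => (t 0) ^ (((1 / 4 : ℚ) : ℝ) - 1) * (1 - t 0) ^ (((1 / 2 : ℚ) : ℝ) - 1)) B₁.domain) :
    AlgebraicIndependent ℚ ![B₁.value, Real.pi] := by
  set K : IntermediateField ℚ ℝ := IntermediateField.adjoin ℚ ({B₁.value, Real.pi} : Set ℝ)
    with hK
  have hBK : B₁.value ∈ K := IntermediateField.subset_adjoin ℚ _ (by simp)
  have hπK : Real.pi ∈ K := IntermediateField.subset_adjoin ℚ _ (by simp)
  refine soloInformed_algebraicIndependent_pair_transfer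
    algebraicIndependent_real_pi_gamma_one_quarter ⟨1, one_pos, by simpa using hπK⟩
    ⟨4, by norm_num, ?_⟩
  rw [soloInformed_gamma_quarter_pow_four B₁ h₁d h₁i]
  exact mul_mem (mul_mem (by exact_mod_cast K.natCast_mem 2) hπK) (pow_mem hBK 2)

/-- **`B(¼,½)` is transcendental.** [Chudnovsky 1984, Ch. 7] -/
theorem soloInformed_transcendental_betaQuarterHalf (B₁ : IntegralRep 1)
    (h₁d : B₁.domain = {t | t 0 ∈ Set.Ioo (0:ℝ) 1})
    (h₁i : Set.EqOn B₁.integrand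
      (fun t => (t 0) ^ (((1 / 4 : ℚ) : ℝ) - 1) * (1 - t 0) ^ (((1 / 2 : ℚ) : ℝ) - 1)) B₁.domain) :
    Transcendental ℚ B₁.value := by
  simpa using (soloInformed_algebraicIndependent_betaQuarterHalf_pi B₁ h₁d h₁i).transcendental 0

end Summit.KontsevichZagierPeriods.KontsevichZagierPeriods.Theorems

end
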